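import Literature.NumberTheory.Rogawski1990.LocalTransfer
import Summits.HodgeConjecture.HodgeConjecture.Theorems.F0P3cStCharTSCayleyUnitary   -- ★ p849523 «CAYLEY★» (LH1-p01): `exists_mem_unitaryGroupOfForm_irreducible_charpoly_of_cayley`
import Literature.NumberTheory.Rogawski1990.CMLocalAPacketMembers                    -- ★ `Gqs`, `qsForm` (the CM local carrier `cmDatum … .Local v`, `cmLocalForm`, `cmDatum_Local_eq`)
import Literature.NumberTheory.Automorphic.UnitaryGroupNonsplitPlace                 -- ★ `LocalRing.isField_of_smul_eq`
import Literature.NumberTheory.Automorphic.QuadraticLocalBaseChange                  -- ★ `conjLocal_algebraMap`, `PlacesOver.nonempty`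
import Literature.NumberTheory.Automorphic.GaloisActionPlaces                        -- ★ `HeightOneSpectrum.valuation_algEquiv_smul`
import Literature.NumberTheory.NumberFields.CMFieldTotallyNegativeGenerator          -- ★ `IsCMField.exists_complexConj_ne`
import HarnessLib

/-!
# Crux `H413`, line LH6 (StCharTS) — brick «T3-ALG★» (A): a `3 × 3` matrix with IRREDUCIBLE characteristic polynomial has no
# eigenvalue in the field, and is regular semisimple (★ `Rogawski1990.LocalTransfer.IsRegularElt`)

Cell `hodgecm-mathlib` (D-0151), FLOOR 0, crux item H413 = `stmt-HodgeConjecture-24833`; line LH6 = closer stub `stub_StCharTS`, leaf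
`Cruxes/H413/Lines/F0_P3c_StCharTSPaydown.lean` ED. 4, organ (S-𝔇) `stub_EllipticPackage`, conjunct (T3) «let `T` be a Cartan subgroup of type (3)»
[Rogawski1990 L. 12.7.2 (proof) p. 194; §3.6]: its regular elements are elliptic regular and their characteristic polynomials have NO root among the
norm-one scalars.  DEAL «T3-ALG★» of F0P3b-plan (g23) 2026-09-02T05:13Z to LH1-p03 (g2); `--supports stmt-HodgeConjecture-24833 --as helper`.
THEOREMS ONLY (no `def`, no instance, no notation, no named fact, no `sorry`); imports ★ `Rogawski1990.LocalTransfer` + HarnessLib.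

PART (A) — pure algebra (Mathlib):
* `not_isRoot_of_irreducible_of_one_lt_natDegree` — an irreducible polynomial of degree `> 1` over a field has no root
  (`Polynomial.degree_eq_one_of_irreducible_of_root`);
* **`not_isRoot_charpoly_of_irreducible`** — for `A ∈ M_n(K)`, `|n| > 1`, `Irreducible A.charpoly ⟹ ∀ c, ¬ A.charpoly.IsRoot c`
  (`Matrix.charpoly_natDegree_eq_dim`), and the `Fin 3` instance `not_isRoot_charpoly_fin_three_of_irreducible` — the EIGENVALUE CLAUSE of (T3):
  a type-(3) element (irreducible cubic characteristic polynomial over `L_w`) has no eigenvalue in `L_w`, in particular none in `L_w¹`;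
* **`isRegularElt_of_irreducible_charpoly`** — over a perfect field (e.g. characteristic `0`) an irreducible characteristic polynomial is separable,
  i.e. `g` is regular semisimple in the sense of ★ `IsRegularElt` (`= charpoly.Separable`; Mathlib `Irreducible.separable`), with the `CharZero` and
  `Fin 3` spellings `isRegularElt_of_irreducible_charpoly_of_charZero`, `isRegularElt_fin_three_of_irreducible_charpoly`.
PART (B) — ED. 2 (§B1–§B4 below): the EXISTENCE of a type-(3) element `γ ∈ U(Φ₃)(L⁺_v) = Gqs L v` at a NON-SPLIT place `v` of `L⁺`:
* §B1 the test matrix `X_c = !![0,0,c; 1,0,0; 0,−1,0]` over any commutative ring: `(σ X_c)ᵀ Φ₃ = −Φ₃ X_c` when `σ c = −c`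
  (`transpose_map_testMatrix_mul_antidiag`), `χ_{X_c} = t³ + c` (`charpoly_testMatrix`), and `t³ + c` without root is irreducible over a domain
  (`irreducible_X_pow_three_add_C`);
* §B2 `exists_imaginary_valuation_log_not_dvd_three`: at a place `w` of the CM field `L` with `c̄ • w = w` there is a purely imaginary `c₀ ∈ L`
  with `3 ∤ v_w(c₀)` (uniformiser `b`, `v_w(b̄) = v_w(b)` ★ `valuation_algEquiv_smul`, so `v_w(b b̄) = −2`);
* §B3 at a non-split `v`: `t³ + c₀` has no root in `L ⊗ L⁺_v = Π_{w ∣ v} L_w` (`pow_three_add_algebraMap_ne_zero`, ★ `valuedAdicCompletion_eq_valuation'`),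
  `2 ≠ 0` there, and `cmLocalForm L 3 v` is the literal anti-diagonal (`cmLocalForm_three_eq`);
* §B4 **`exists_irreducible_charpoly_of_nonsplit`**: `∃ γ : Gqs L v, Irreducible χ_γ` — the CAYLEY TRANSFORM of `X_{c₀}` via ★ p849523 «CAYLEY★»
  `F0P3cStCharTSCayleyUnitary.exists_mem_unitaryGroupOfForm_irreducible_charpoly_of_cayley` (LH1-p01 (g3)), in the field structure of
  `Π_{w ∣ v} L_w` at a non-split place (★ `LocalRing.isField_of_smul_eq`).  With (A): such a `γ` is regular semisimple with no eigenvalue in `L_w`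
  — a generator of a Cartan subgroup of TYPE (3) [Rogawski1990 §3.6].

HONEST LABEL: count-neutral kit; HC_CM is proved only modulo the 7 printed citations (2 remaining: hLiu418 = stmt-HodgeConjecture-24832, h413 =
stmt-HodgeConjecture-24833) until rung 0 closes.

## References
* [Rogawski1990] J. D. Rogawski, *Automorphic Representations of Unitary Groups in Three Variables*, Ann. of Math. Stud. 123 (1990): §3.1 p. 19 (regular
  elements), §3.6 (Cartan subgroups of `U(3)`, types (0)–(3)), Lemma 12.7.2 (proof) p. 194.
-/

set_option autoImplicit false
-- the mandated namespace has the single-problem summit's repeated segment (`HodgeConjecture.HodgeConjecture`)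
set_option linter.dupNamespace false

namespace Summit.HodgeConjecture.HodgeConjecture.Cruxes.H413.F0P3cStCharTSTypeThreeTorus

open Polynomial
open Literature.NumberTheory.Rogawski1990

/-! ## §A1 Irreducible polynomials of degree `> 1` have no root -/

/-- An irreducible polynomial of degree `> 1` over a field has no root (a root gives the factor `X − c`, forcing degree `1`).
[cite: Rogawski1990, §3.6] -/
theorem not_isRoot_of_irreducible_of_one_lt_natDegree {K : Type*} [Field K] {p : K[X]} (hp : Irreducible p)
    (hdeg : 1 < p.natDegree) (c : K) : ¬ p.IsRoot c := by
  intro h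
  have h1 : p.degree = 1 := degree_eq_one_of_irreducible_of_root hp h
  have h2 : p.natDegree = 1 := natDegree_eq_of_degree_eq_some h1
  omega

/-- **A square matrix of size `> 1` with irreducible characteristic polynomial has no eigenvalue in the field**:
`Irreducible A.charpoly ⟹ ¬ A.charpoly.IsRoot c` (`deg charpoly = |n|`). [cite: Rogawski1990, §3.6] -/
theorem not_isRoot_charpoly_of_irreducible {K : Type*} [Field K] {n : Type*} [Fintype n] [DecidableEq n]
    (hn : 1 < Fintype.card n) (A : Matrix n n K) (hA : Irreducible A.charpoly) (c : K) : ¬ A.charpoly.IsRoot c :=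
  not_isRoot_of_irreducible_of_one_lt_natDegree hA (by rwa [Matrix.charpoly_natDegree_eq_dim]) c

/-- **The eigenvalue clause of (T3) for `3 × 3` matrices**: an irreducible cubic characteristic polynomial has no root in the field — in particular
a type-(3) element of `U(Φ₃)(L⁺_v)` (characteristic polynomial irreducible over `L_w`) has no eigenvalue among the norm-one scalars `L_w¹`.
[cite: Rogawski1990, §3.6; Lemma 12.7.2 (proof) p. 194] -/
theorem not_isRoot_charpoly_fin_three_of_irreducible {K : Type*} [Field K] (A : Matrix (Fin 3) (Fin 3) K)
    (hA : Irreducible A.charpoly) (c : K) : ¬ A.charpoly.IsRoot c :=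
  not_isRoot_charpoly_of_irreducible (by rw [Fintype.card_fin]; norm_num) A hA c

/-! ## §A2 Irreducible characteristic polynomial ⟹ regular semisimple -/

/-- **Over a perfect field, an element of `GL_n` with irreducible characteristic polynomial is regular semisimple** (★ `IsRegularElt g` =
`charpoly.Separable`; an irreducible polynomial over a perfect field is separable). [cite: Rogawski1990, §3.1 p. 19; §3.6] -/
theorem isRegularElt_of_irreducible_charpoly {K : Type*} [Field K] [PerfectField K] {n : Type*} [Fintype n] [DecidableEq n]
    (g : GL n K) (h : Irreducible (g : Matrix n n K).charpoly) : IsRegularElt g :=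
  PerfectField.separable_of_irreducible h

/-- The characteristic-zero spelling (the local fields `L_w` have characteristic `0`). [cite: Rogawski1990, §3.1 p. 19; §3.6] -/
theorem isRegularElt_of_irreducible_charpoly_of_charZero {K : Type*} [Field K] [CharZero K] {n : Type*} [Fintype n]
    [DecidableEq n] (g : GL n K) (h : Irreducible (g : Matrix n n K).charpoly) : IsRegularElt g :=
  isRegularElt_of_irreducible_charpoly g h

/-- The `3 × 3` spelling of the dealer's signature: `Irreducible (g : Matrix (Fin 3) (Fin 3) K).charpoly → IsRegularElt g` in characteristic `0`.
[cite: Rogawski1990, §3.1 p. 19; §3.6] -/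
theorem isRegularElt_fin_three_of_irreducible_charpoly {K : Type*} [Field K] [CharZero K] (g : GL (Fin 3) K)
    (h : Irreducible (g : Matrix (Fin 3) (Fin 3) K).charpoly) : IsRegularElt g :=
  isRegularElt_of_irreducible_charpoly g h

/-- A regular element with irreducible characteristic polynomial: BOTH (T3) outputs at once (regular semisimple, and no eigenvalue `c ∈ K`).
[cite: Rogawski1990, §3.6; Lemma 12.7.2 (proof) p. 194] -/
theorem isRegularElt_and_not_isRoot_of_irreducible_charpoly {K : Type*} [Field K] [CharZero K] (g : GL (Fin 3) K)
    (h : Irreducible (g : Matrix (Fin 3) (Fin 3) K).charpoly) :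
    IsRegularElt g ∧ ∀ c : K, ¬ (g : Matrix (Fin 3) (Fin 3) K).charpoly.IsRoot c :=
  ⟨isRegularElt_of_irreducible_charpoly g h, not_isRoot_charpoly_fin_three_of_irreducible _ h⟩

open NumberField IsDedekindDomain
open scoped Matrix
open Literature.NumberTheory.Automorphic Literature.NumberTheory.Automorphic.UnitaryGroup
open Summit.HodgeConjecture.HodgeConjecture.Cruxes.H413.F0P3cStCharTSCayleyUnitary

/-! ## §B1 The test matrix `X_c = !![0,0,c; 1,0,0; 0,−1,0]`: in the Lie algebra of `U(σ, Φ₃)` iff `σ c = −c`; `χ = t³ + c` -/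

section TestMatrix

variable {R : Type*} [CommRing R]

/-- Mok's anti-diagonal `Φ₃` as a literal matrix. [cite: Mok2014, §1 Notation p. 5] -/
theorem antidiag_three_eq_literal :
    (Matrix.of fun i j : Fin 3 => if j = i.rev then (1 : R) else 0) = !![0, 0, 1; 0, 1, 0; 1, 0, 0] := by
  ext i j
  fin_cases i <;> fin_cases j <;>
    first | (rw [Matrix.of_apply, if_pos (by decide)]; rfl) | (rw [Matrix.of_apply, if_neg (by decide)]; rfl)

/-- **`X_c` lies in the Lie algebra `{X | (σX)ᵀ Φ₃ = −Φ₃ X}` of `U(σ, Φ₃)` when `σ c = −c`.** [cite: Rogawski1990, §3.6] -/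
theorem transpose_map_testMatrix_mul_antidiag (σ : R →+* R) (c : R) (hc : σ c = -c) :
    ((!![0, 0, c; 1, 0, 0; 0, -1, 0] : Matrix (Fin 3) (Fin 3) R).map σ)ᵀ * !![0, 0, 1; 0, 1, 0; 1, 0, 0] =
      -(!![0, 0, 1; 0, 1, 0; 1, 0, 0] * !![0, 0, c; 1, 0, 0; 0, -1, 0]) := by
  ext i j
  fin_cases i <;> fin_cases j <;> simp [Matrix.mul_apply, Fin.sum_univ_three, hc]

/-- **`χ_{X_c} = t³ + c`.** [cite: Rogawski1990, §3.6] -/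
theorem charpoly_testMatrix (c : R) :
    ((!![0, 0, c; 1, 0, 0; 0, -1, 0] : Matrix (Fin 3) (Fin 3) R)).charpoly = X ^ 3 + C c := by
  rw [Matrix.charpoly, Matrix.det_fin_three]
  simp
  ring

/-- Over a domain, `t³ + c` with NO root `r` (`r³ + c ≠ 0` for all `r`) is irreducible (monic of degree `3`).
[cite: Rogawski1990, §3.6] -/
theorem irreducible_X_pow_three_add_C [IsDomain R] (c : R) (h : ∀ r : R, r ^ 3 + c ≠ 0) :
    Irreducible (X ^ 3 + C c : R[X]) := by
  rw [Polynomial.Monic.irreducible_iff_roots_eq_zero_of_degree_le_three (monic_X_pow_add_C c (by norm_num))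
    (by rw [natDegree_X_pow_add_C]; norm_num) (by rw [natDegree_X_pow_add_C]), Multiset.eq_zero_iff_forall_notMem]
  intro r hr
  rw [mem_roots (monic_X_pow_add_C c (by norm_num)).ne_zero, IsRoot.def, eval_add, eval_pow, eval_X, eval_C] at hr
  exact h r hr

end TestMatrix

/-! ## §B2 A purely imaginary element of the CM field whose valuation at a conjugation-stable place is not a cube -/

/-- **At a place `w` of the CM field `L` fixed by complex conjugation there is a purely imaginary `c₀ ∈ L` (`c̄₀ = −c₀`, `c₀ ≠ 0`) whose
`w`-adic valuation is NOT divisible by `3`**: with `a = x − x̄ ≠ 0` and a uniformiser `b` at `w`, `v_w(b̄) = v_w(b)` since `c̄ • w = w`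
(★ `valuation_algEquiv_smul`), so `v_w(b b̄) = −2` and one of `a`, `a · b b̄` has valuation `≢ 0 (mod 3)`. [cite: Rogawski1990, §3.6] -/
theorem exists_imaginary_valuation_log_not_dvd_three (L : Type) [Field L] [NumberField L] [IsCMField L]
    (w : HeightOneSpectrum (𝓞 L)) (hw : IsCMField.complexConj L • w = w) :
    ∃ c₀ : L, IsCMField.complexConj L c₀ = -c₀ ∧ c₀ ≠ 0 ∧ ¬ (3 : ℤ) ∣ WithZero.log (w.valuation L c₀) := by
  -- a non-zero purely imaginary element
  obtain ⟨x, hx⟩ := Literature.NumberTheory.NumberFields.IsCMField.exists_complexConj_ne L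
  have hca : IsCMField.complexConj L (x - IsCMField.complexConj L x) = -(x - IsCMField.complexConj L x) := by
    rw [map_sub, IsCMField.complexConj_apply_apply, neg_sub]
  have ha0 : x - IsCMField.complexConj L x ≠ 0 := sub_ne_zero.2 (Ne.symm hx)
  -- a uniformiser at `w` and its norm
  obtain ⟨b, hb⟩ := w.valuation_exists_uniformizer L
  have hb0 : b ≠ 0 := by
    intro h; rw [h, map_zero] at hb; exact WithZero.zero_ne_coe hb
  have hcb : w.valuation L (IsCMField.complexConj L b) = WithZero.exp (-1 : ℤ) := by
    have h := Literature.NumberTheory.Automorphic.HeightOneSpectrum.valuation_algEquiv_smul _ (IsCMField.complexConj L) w b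
    rw [hw] at h
    rw [h, hb]
  have hN : w.valuation L (b * IsCMField.complexConj L b) = WithZero.exp (-2 : ℤ) := by
    rw [map_mul, hb, hcb, ← WithZero.exp_add]; norm_num
  have hcN : IsCMField.complexConj L (b * IsCMField.complexConj L b) = b * IsCMField.complexConj L b := by
    rw [map_mul, IsCMField.complexConj_apply_apply, mul_comm]
  have hva0 : w.valuation L (x - IsCMField.complexConj L x) ≠ 0 := (Valuation.ne_zero_iff _).2 ha0
  by_cases h3 : (3 : ℤ) ∣ WithZero.log (w.valuation L (x - IsCMField.complexConj L x))
  · -- use `a · (b b̄)`: valuation `log v(a) − 2`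
    refine ⟨(x - IsCMField.complexConj L x) * (b * IsCMField.complexConj L b), ?_,
      mul_ne_zero ha0 (mul_ne_zero hb0 (by rw [ne_eq, map_eq_zero]; exact hb0)), ?_⟩
    · rw [map_mul, hca, hcN, neg_mul]
    · rw [map_mul, hN, WithZero.log_mul hva0 WithZero.exp_ne_zero, WithZero.log_exp]
      omega
  · exact ⟨x - IsCMField.complexConj L x, hca, ha0, h3⟩

/-! ## §B3 The local ring `L ⊗ L⁺_v = Π_{w ∣ v} L_w` at a non-split place: no cube root of `−c₀`, `2 ≠ 0`, the local `Φ₃` -/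

variable (L : Type) [Field L] [NumberField L] [IsCMField L]

omit [IsCMField L] in
/-- An element `c₀ ∈ L` with `3 ∤ v_w(c₀)` has no cube root of `−c₀` in `Π_{w' ∣ v} L_{w'}` (read at the component `w`:
`3 · v(r_w) = v_w(c₀)` is impossible). [cite: Rogawski1990, §3.6] -/
theorem pow_three_add_algebraMap_ne_zero (v : HeightOneSpectrum (𝓞 ↥(maximalRealSubfield L))) (w : PlacesOver L v)
    {c₀ : L} (h3 : ¬ (3 : ℤ) ∣ WithZero.log (w.1.valuation L c₀)) (r : LocalRing L v) :
    r ^ 3 + algebraMap L (LocalRing L v) c₀ ≠ 0 := by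
  intro h
  have hw : (r w) ^ 3 + algebraMap L (w.1.adicCompletion L) c₀ = 0 := by
    have hw := congrFun h w
    simp only [Pi.add_apply, Pi.pow_apply, Pi.algebraMap_apply, Pi.zero_apply] at hw
    exact hw
  have hval : Valued.v (r w) ^ 3 = w.1.valuation L c₀ := by
    rw [← map_pow, eq_neg_of_add_eq_zero_left hw, Valuation.map_neg]
    exact HeightOneSpectrum.valuedAdicCompletion_eq_valuation' w.1 c₀
  have hlog := congrArg WithZero.log hval
  rw [WithZero.log_pow] at hlog
  exact h3 ⟨WithZero.log (Valued.v (r w)), by rw [← hlog, nsmul_eq_mul]; norm_num⟩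

omit [IsCMField L] in
/-- `2 ≠ 0` in `Π_{w ∣ v} L_w` (characteristic `0`). [folklore] -/
private theorem two_ne_zero_localRing (v : HeightOneSpectrum (𝓞 ↥(maximalRealSubfield L))) (w : PlacesOver L v) :
    (2 : LocalRing L v) ≠ 0 := by
  intro h
  have h2 : (2 : w.1.adicCompletion L) = 0 := by
    have h2 := congrFun h w
    simp only [Pi.ofNat_apply] at h2
    exact h2
  have h2' : algebraMap L (w.1.adicCompletion L) 2 = algebraMap L (w.1.adicCompletion L) 0 := by
    rw [map_ofNat, map_zero, h2]
  exact two_ne_zero ((algebraMap L (w.1.adicCompletion L)).injective h2')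

omit [IsCMField L] in
/-- The local split form `Φ₃` over `Π_{w ∣ v} L_w` is the literal anti-diagonal (★ `cmLocalForm_eq_over`, ★ `StdForm.antidiagonal_J_apply`).
[cite: Mok2014, §1 Notation p. 5] -/
theorem cmLocalForm_three_eq (v : HeightOneSpectrum (𝓞 ↥(maximalRealSubfield L))) :
    cmLocalForm L 3 v = !![0, 0, 1; 0, 1, 0; 1, 0, 0] := by
  rw [cmLocalForm_eq_over, ← antidiag_three_eq_literal]
  ext i j
  simp only [StdForm.over, Matrix.map_apply, StdForm.antidiagonal_J_apply, Matrix.of_apply]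
  split_ifs <;> simp

/-! ## §B4 The type-(3) element -/

/-- **(B) «TYPE-(3) ELEMENT EXISTS»: at a NON-SPLIT finite place `v` of `L⁺` the quasi-split local group `U(Φ₃)(L⁺_v) = Gqs L v` contains
an element whose characteristic polynomial is IRREDUCIBLE over `L ⊗ L⁺_v = L_w`** — the Cayley transform (★ «CAYLEY★» p849523,
`exists_mem_unitaryGroupOfForm_irreducible_charpoly_of_cayley`) of the Lie-algebra element `X = !![0,0,c₀; 1,0,0; 0,−1,0]` (`(σX)ᵀ Φ₃ = −Φ₃ X`
iff `c̄₀ = −c₀`, §B1) with `χ_X = t³ + c₀`, `3 ∤ v_w(c₀)` (§B2), so that `χ_X` has no root (§B3) and is irreducible; a Cartan subgroup of TYPE (3)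
of [Rogawski1990, §3.6] is the centraliser of such an element. [cite: Rogawski1990, §3.6; Lemma 12.7.2 (proof) p. 194] -/
theorem exists_irreducible_charpoly_of_nonsplit (v : HeightOneSpectrum (𝓞 ↥(maximalRealSubfield L)))
    (hv : ∀ w : PlacesOver L v, IsCMField.complexConj L • w.1 = w.1) :
    ∃ γ : Gqs L v, Irreducible ((γ.val.val : Matrix (Fin 3) (Fin 3) (UnitaryGroup.LocalRing L v)).charpoly) := by
  classical
  have hc1 : IsCMField.complexConj L ≠ 1 := IsCMField.complexConj_ne_one L
  obtain ⟨w⟩ := (inferInstance : Nonempty (PlacesOver L v))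
  have hw : IsCMField.complexConj L • w.1 = w.1 := hv w
  -- `R = L ⊗ L⁺_v` is a field (one place above `v`)
  have hF : IsField (LocalRing L v) := LocalRing.isField_of_smul_eq (IsCMField.complexConj L) hc1 w hw
  haveI : IsDomain (LocalRing L v) := hF.isDomain
  -- the imaginary element with valuation not a cube, read in `R`
  obtain ⟨c₀, hcc₀, -, h3⟩ := exists_imaginary_valuation_log_not_dvd_three L w.1 hw
  have hσc : conjLocal L (IsCMField.complexConj L) v (algebraMap L (LocalRing L v) c₀) = -algebraMap L (LocalRing L v) c₀ := by
    rw [conjLocal_algebraMap, hcc₀, map_neg]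
  -- the Lie-algebra element and its characteristic polynomial
  have hLie : ((!![0, 0, algebraMap L (LocalRing L v) c₀; 1, 0, 0; 0, -1, 0] : Matrix (Fin 3) (Fin 3) (LocalRing L v)).map
        (conjLocal L (IsCMField.complexConj L) v))ᵀ * cmLocalForm L 3 v =
      -(cmLocalForm L 3 v * !![0, 0, algebraMap L (LocalRing L v) c₀; 1, 0, 0; 0, -1, 0]) := by
    rw [cmLocalForm_three_eq]
    exact transpose_map_testMatrix_mul_antidiag _ _ hσc
  have hirr : Irreducible ((!![0, 0, algebraMap L (LocalRing L v) c₀; 1, 0, 0; 0, -1, 0] :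
      Matrix (Fin 3) (Fin 3) (LocalRing L v))).charpoly := by
    rw [charpoly_testMatrix]
    exact irreducible_X_pow_three_add_C _ (pow_three_add_algebraMap_ne_zero L v w h3)
  -- Cayley transform (★ «CAYLEY★»), in the field structure of `R`
  letI : Field (LocalRing L v) := hF.toField
  obtain ⟨g, hg, -, hgirr⟩ := exists_mem_unitaryGroupOfForm_irreducible_charpoly_of_cayley
    (conjLocal L (IsCMField.complexConj L) v) (two_ne_zero_localRing L v w) hLie hirr
  exact ⟨⟨g, hg⟩, hgirr⟩

end Summit.HodgeConjecture.HodgeConjecture.Cruxes.H413.F0P3cStCharTSTypeThreeTorus
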